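import Summits.QuantumFields.YangMills.Theorems.BalabanUVNodesPortS1RecordH1LocalPieces
import Summits.QuantumFields.YangMills.Theorems.BalabanUVNodesPortS1FWPiecesNormed

/-!
# Port S₁ of ⟨stmt-QuantumFields-27930⟩ — the letter (D-loc), VOLUME-UNIFORM SUCCESSOR EDITION `RecordH1LocalPiecesFam` (LEAF DEF; ★★★ director-ym №686; RR-2 READ 27; ◆ CRIT-1 O.6579)

SUPERSEDES `RecordH1LocalPieces` (✓p837718), whose conjunct (i) is volume-extensive on print's model (RR-2 READ 27, ◆ O.6579).  That decl stays in the tree as bytes of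
record and is NOT to be supplied, cited as a hypothesis, or consumed (№686 (1)); this file imports its module only for the sound σ₀-proximity words ✓`Near`, ✓`FineAgreeNear`
(declare-once).

The landed letter ✓`RecordH1LocalPieces F Ms κ₁ B₀ εFW` (✓p837718, bytes of record, untouched) types clause (i)'s second half as a GLOBAL ℓ¹ row
`∑ ω, ‖piece εbg U ω‖ · e^{κ₁|supp ω|} ≤ B₀e^{16κ₁}` over ALL pieces, with ABSOLUTE `B₀`, under `∀ k K`.  That row is VOLUME-EXTENSIVE (second reader RR-2, READ 27,
2026-08-31T23:30Z): the number of σ₀-cubes `Fintype.card (CubeIdxAt F Ms k K)` grows like `(2L^{m+K−k}∕Ms)⁴`, every cube is met by pieces of total norm `≥ c` (cover + the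
right-inverse row `Q_k H₁ = 1` at the pinned datum), and `κ₁·m ≤ e^{κ₁ m}` gives `∑ ≥ κ₁·c·#cubes` — unbounded for every `κ₁ > 0`; at `κ₁ = 0` the row has no locality content.
PRINT is volume-UNIFORM: [II] (1.7) = [B9] (3.108) is a per-walk KERNEL bound whose ω-sum is taken at FIXED localization cubes (p.3 L18–23 «Δ(y), Δ(y′) are localization
cubes of the term … the first two factors in (1.7) are used to control the sum over ω, and they determine the constant B₀») — an ANCHORED sum — and (1.11) is an OPERATOR-norm
bound for the s-inserted FAMILY on the polydisc `|s(□)| ≤ e^{κ}` (p.5).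

THIS EDITION (remedy (R3) of READ 27 — the smallest print-true change): clause (i) := cover ∧ **print's (1.11) row for the s-inserted piece family itself**,
`∀ U, ∀ s ∈ sPolydisc (CubeIdxAt F Ms k K) (e^{κ₁}), ‖pieceFamilyN supp (piece εbg U) s‖ ≤ B₀ · e^{16κ₁}` (✓`FWPiecesNormed.pieceFamilyN supp T s = ∑ ω (∏_{Δ ∈ supp ω} s Δ) • T ω`,
✓p837484), uniformly in the volume; connected supports, (ii) U-locality on shadows under ✓`FineAgreeNear`, (iii) the pin to ✓`recordH1` at the record configuration of a guarded
`Vk` — VERBATIM as landed.  The per-walk summability (1.7) with its anchored ω-sums is the SUPPLIER's internal route to (1.11) (remedy (R1) of READ 27 would display it as an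
anchored ℓ¹ row; not needed by the consumer).  (The successor only WEAKENS the landed letter — the extensive row implies (1.11) by ✓`norm_pieceFamilyN_le` — but no
theorem consuming the old decl is filed, per №686 (1).)  SCOPE as before (◆ O-1): (i)(ii) over ALL `U` (guard on `εbg` only), off the class the supplier
serves the localized pieces where locally defined near `supp ω` ([B9] p.394) and `0` elsewhere, which only decreases the left side of (1.11).

STATUS: `def … : Prop` — OPEN, inhabited nowhere; supplier: the random-walk expansion [B9] §3 + Thm 3.12 at guarded data (seat joined to the K0ᴬ {W2} road decision, ★★★ №681 (3));
consumer: node A's `h0Rows_of_localPieces` (memo v27.11 on), which now reads R4 = (1.11) OFF THIS ROW instead of through ✓`bounds_pieceFamilyN`'s extensive hypothesis.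
E-guard (xxvi) VOLUME-UNIFORMITY (RR-2): every norm∕summability row with absolute constants under `∀ k K` tested against `#CubeIdxAt → ∞` — this row is an operator-norm bound
(sup-type carriers), anchored by construction.

[cite: Balaban1988RG2Cluster, (1.6)–(1.7) p.3, p.3 L18–23, (1.11) p.5; Balaban1985BackgroundPropagators, (3.107)–(3.108) p.416, p.394 L31–33; Balaban1985Variational, (174) p.305]
-/

open scoped BigOperators Matrix.Norms.L2Operator

namespace Summit.QuantumFields.YangMills.Theorems.BalabanUVNodesPortS1

open Summit.QuantumFields.YangMills.Theorems.K0RecordFormatNames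
open Summit.QuantumFields.YangMills.Theorems.BalabanUVNodesPortS1.FHInterface
open Summit.QuantumFields.YangMills.Theorems.BalabanUVNodesPortS1.FWPieces (Covers SuppConnected CubeFaceAdj)
open Summit.QuantumFields.YangMills.Theorems.BalabanUVNodesPortS1.FWPiecesNormed (pieceFamilyN)
open Literature.MathematicalPhysics.QuantumFieldTheory.Balaban1983to89
open Literature.MathematicalPhysics.QuantumFieldTheory.Balaban1983to89.Node00
open Literature.MathematicalPhysics.QuantumFieldTheory.Balaban1983to89.T4Continuum (T4Family)
open Literature.MathematicalPhysics.QuantumFieldTheory.Balaban1983to89.B11Eq115Space (NegSize)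

/-- **(D-loc), volume-uniform edition — «`H₀(U)` is a finite sum of cube-localized, U-local pieces whose s-inserted family obeys (1.11) on the polydisc of radius `e^{κ₁}`»**,
at ABSOLUTE `(Ms, κ₁, B₀, εFW)`, for every guarded level pair and every record datum `(Ω, levB)`: finitely many pieces `T_ω(εbg, U) : 𝔅 →L[ℂ] Space115Lit … U` with CONNECTED
cube supports (common wall), which at every admissible `εbg` (i) COVER the cubes of both arguments (read on the shadows, ✓`FWPieces.Covers`) and whose s-inserted family
✓`pieceFamilyN supp (piece εbg U)` is bounded by print's `B₀e^{16κ₁}` in the (77)→(115) operator norm on ✓`sPolydisc _ (e^{κ₁})` ([II] (1.11) — volume-uniform; NOT the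
extensive global ℓ¹ row of the landed ✓`RecordH1LocalPieces`, RR-2 READ 27); (ii) are U-LOCAL on shadows: configurations agreeing near `supp ω` give the same shadow of `T_ω`;
(iii) at the record configuration `U = UkSel F 2 K k εbg Vk` of a guarded `Vk` the shadow of `Σ_ω T_ω` restricted to real traceless block fields is ✓`recordH1 F k K εbg Vk`
(= `H₁` of [15] (103)∕(174), the B-slot of the LANDAU representation).  SCOPE (◆ O-1): (i)(ii) range over ALL `U` (guard on `εbg` only), (iii) at the record datum only — off the
class the supplier serves the localized pieces where locally defined near `supp ω` and `0` elsewhere.  Supplier: the random-walk expansion ([B9] §3 + Thm 3.12; [II] (1.6)–(1.7)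
with ANCHORED ω-sums ⇒ (1.11)).  OPEN; inhabited nowhere. [cite: Balaban1988RG2Cluster, (1.6)–(1.7) p.3, p.3 L18–23, (1.11) p.5; Balaban1985BackgroundPropagators,
(3.107)–(3.108) p.416; Balaban1985Variational, (174) p.305] -/
def RecordH1LocalPiecesFam (F : T4Family) (Ms : ℕ) (κ₁ B₀ εFW : ℝ) : Prop :=
  ∀ k K : ℕ, k ≤ K →
    haveI := factL F; haveI := factEta F K k; haveI := factC0 F K k; haveI := wBRec_fact F K k
    ∀ (Ω : ℕ → Set (Site (F.P K) 0)), (∀ x, x ∈ Ω k) → ∀ (levB : PBond (F.P K) k → ℕ),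
      ∃ (n : ℕ) (supp : Fin n → Finset (CubeIdxAt F Ms k K))
        (piece : ℝ → (U : GaugeField (F.P K) 0 (SU 2)) → Fin n →
          (NegSize (F.L : ℝ) ((F.P K).eta k) levB 0 (Matrix (Fin 2) (Fin 2) ℂ) →L[ℂ] Space115Lit F 2 K k Ω U)),
        (∀ ω, SuppConnected CubeFaceAdj (supp ω)) ∧
        ∀ εbg : ℝ, 0 < εbg → εbg ≤ εFW →
          (∀ U : GaugeField (F.P K) 0 (SU 2),
              Covers (cubeOfFluctIdx F Ms k k K) (cubeOfFineIdx F Ms k K) supp (fun ω => recordHfwOfH F K k Ω U levB (piece εbg U ω)) ∧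
              ∀ s ∈ sPolydisc (CubeIdxAt F Ms k K) (Real.exp κ₁), ‖pieceFamilyN supp (piece εbg U) s‖ ≤ B₀ * Real.exp (16 * κ₁)) ∧
          (∀ (U U' : GaugeField (F.P K) 0 (SU 2)) (ω : Fin n), (∀ Δ ∈ supp ω, FineAgreeNear F Ms k K Δ U U') →
              recordHfwOfH F K k Ω U levB (piece εbg U ω) = recordHfwOfH F K k Ω U' levB (piece εbg U' ω)) ∧
          (∀ Vk : GaugeField (F.P K) k (SU 2), PlaqSmall εbg Vk → ∀ x : FluctIdx F k K → ℝ,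
              recordHfwOfH F K k Ω (UkSel F 2 K k εbg Vk) levB (∑ ω, piece εbg (UkSel F 2 K k εbg Vk) ω) (fluctRealEmb F k K x) =
                fineRealEmb F K (recordH1 F k K εbg Vk x))


end Summit.QuantumFields.YangMills.Theorems.BalabanUVNodesPortS1
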